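import Summits.QuantumFields.YangMills.Theorems.BalabanUVNodesN27LedgerJoinPackage
import Summits.QuantumFields.YangMills.Theorems.BalabanUVNodesN17KnitTransfer
import Summits.QuantumFields.YangMills.Theorems.BalabanUVNodesN17AtBetaOfRecord

/-!
# BalabanUVNodes ∕ N27 spine-record join, VIII — N17 ITSELF BY NAME on dag-n17-a's AF-FREE gap road, and N17 AT THE β OF RECORD:
# `NE4OnData D c θ γ₄` (node N17's decl of record) + node U2's history moduli + the PRINTED-type upper bound on β, in place of the
# out-edge `hU2`, into the Link-by-name joins of files VI∕VII; and the same with `D.βfun = Node00.betaOfMerged βm β⁰ γ` (the Stage-8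
# datum's β by construction), every β-side hypothesis read on the merged family `βm`
# (cell `pub-ymgap`, HUMAN RULING D-0062 Track A, seat `pub-ymgap-dag-n27-a` g3; `--supports stmt-QuantumFields-19182`, count-neutral)

WHY.  Files VI∕VII take the edge N17 → N27 as dag-n17-a's prefix-level conclusion `hU2 : D.UnderHypotheses Hβ (U2Output D g₀ Cd θc)`.
File II (`…JoinN17`, g2) produced that edge from N17 ITSELF on the older road `N17Knit.nodeU2_of_N17` (relative analytic charts
`NE4.LocalAnalyticRel`).  dag-n17-a has since LANDED the AF-FREE GAP ROAD `N17KnitTransfer.u2Output_under_of_N17_gap` (p411569): N17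
`NE4OnData D c θ γ₄` + node U2's history moduli `HistLipschitz Λ₄ γ₄ D.βfun`, `FadingMemory C₄ ν Λ₄` (memory rate `ν < θ`) + the PRINTED-type
upper bound `BetaUpperH β′ γ₄ D.βfun` with `γ₄²β′ < 1` ⇒ `D.UnderHypotheses Hβ (U2Output D g₀ (2c∕(1−θ)) θ)` for EVERY `Hβ` — no `EventualLowerH`,
no window binder, no analytic charts; and `N17AtBetaOfRecord` (p413688): at a datum whose β-family IS the β of record, N17 and the moduli are
the same statements about the merged family `βm` (`N17_atRecord_iff_merged`, `histLipschitz_betaOfMerged_iff`; the upper bound by dag-n28-a's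
`N28AtBetaOfRecord.betaUpperH_betaOfMerged_iff`).  THIS module composes them with VII §1 ∕ VI §3, so that B5 at the datum is concluded from
the record decls N16 · N17 · N18 · N22 · `LedgerAt` · N20 · N21 + E1∕E2 + the printed-grade brackets + ONE printed-type β bound — and, at
the β of record, from the SAME list read on `βm`.

WHAT IS KERNEL-CHECKED ([bookkeeping] ∕ [folklore]; 0 `def`, 0 `sorry`).
* §1 `hybridNE7Under_of_ledgerPackage_tuned_of_N17` — VII §1 with `hU2` REPLACED by N17 itself + moduli + `BetaUpperH` (node U2's output at
  `Cd := 2c∕(1−θ)`, `θc := θ`; the ledger's rate ordering reads `max ω θ < L.θ′`); `hybridNE7Under_of_ledgerAtDatum_tuned_of_N17` — the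
  same over VI §3's named-hypotheses form.
* §2 `hybridNE7Under_of_ledgerPackage_tuned_atBetaOfRecord` — §1 at a datum with `D.βfun = Node00.betaOfMerged βm β⁰ γ`, box side
  `γ₄ ≤ γ`: N17 as `ScaleShiftRate c θ γ₄ βm`, moduli `HistLipschitz Λ₄ γ₄ βm`, bound `BetaUpperH β′ γ₄ βm` — all on the MERGED family;
  `hybridNE7Under_of_ledgerAtDatum_tuned_atBetaOfRecord` likewise.
* §3 `hybridNE7Under_of_ledgerPackage_tuned_of_declColumns` — every K4 child by its DECL column: N16 `NE3Shape`, N17 `NE4OnData D`, N18 `NE5`,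
  N22 `NE9 ∧ FadingMemory`; K5 by `RelWeightBound` ∕ `ShellWeightBound` ∕ `LedgerAt` — the field-by-field table of `HybridNE7` in theorem form.

HONEST FRAMING.  COMPOSITE-node bookkeeping with the children's children as hypotheses: NE3∕NE4∕NE5∕NE9∕NE7b∕NE7c are HYPOTHESIS SHAPES (none
printed for Bałaban's d = 4 procedure, none proved); `LedgerAt` is NODE O content typed by dag-n19-b; node U2's history moduli and the β upper
bound are binders (printed TYPE only: [Balaban1987RG1] Thm 2 p. 259, (0.20) p. 256, p. 298 — located in the imported modules); `betaOfMerged`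
is NODE 00's β of record as a FUNCTION of an abstract merged family `βm` and one-loop numbers `β⁰` — nothing of Bałaban's instantiated; NO node
is discharged; (B) and `Hβ` are antecedents, used, never refuted; one fixed finite four-torus — NOT ℝ⁴, NOT infinite volume, NOT OS axioms,
NOT a mass gap, NOT Clay.  Typed 28∕28; the discharged count is not touched by this file.  No decl below carries a cite tag.
-/

open Finset MeasureTheory

namespace Summit.QuantumFields.YangMills.Theorems.BalabanUVNodesN27SpineRecord

open Literature.MathematicalPhysics.QuantumFieldTheory.Balaban1983to89
open Literature.MathematicalPhysics.QuantumFieldTheory.Balaban1983to89.FlowStep (HBeta BetaUpperH)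
open Literature.MathematicalPhysics.QuantumFieldTheory.Balaban1983to89.T4CouplingMatching (ScaleShiftRate HistLipschitz)
open Literature.MathematicalPhysics.QuantumFieldTheory.Balaban1983to89.T4Continuum
open T4OutputRate T4RecentScale T4GoodClassBudget T4CauchySum T4TowerRateComposition T4TowerRateDischarge T4TermwiseBudget
open T4WeightBudget (RelWeightBound)
open T4IndicatorShell (ShellWeightBound)
open T4EtaRateMin (Readings LocalRate)
open T4RateLiaison (GaugeDominated)
open T4FlagMemory (extd)
open FlowStep (prefixOf)
open Literature.MathematicalPhysics.QuantumFieldTheory.Balaban1983to89.Node00 (betaOfMerged)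
open Summit.QuantumFields.BalabanUV.T4Continuum.Spine
open Summit.QuantumFields.BalabanUV.T4Continuum.Spine.NE4 (NE4OnData U2Output runFlow)
open Summit.QuantumFields.YangMills.BalabanUVNodes.N19SizeWindow (LedgerData LedgerAt)
open Summit.QuantumFields.YangMills.Theorems.BalabanUVNodesN17 (u2Output_under_of_N17_gap N17_atRecord_iff_merged
  histLipschitz_betaOfMerged_iff)
open Summit.QuantumFields.YangMills.BalabanUVNodes.N28AtBetaOfRecord (betaUpperH_betaOfMerged_iff)

section Datum

variable {F : T4Family} {G : Type*} [GaugeGroup G] [MeasurableSpace G] [HaarData G]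
  {C : Carriers} {ι X : Type} [MeasurableSpace ι]
  {R : Readings ι X} {Wset : Set (ℕ → ℝ)} {EA : Functional C C.BgA} {EB : Functional C C.BgB}
  {κ θ₅ C₅ C₉ ω C₃ θ₃ P γu : ℝ} {q : ℕ} {Λm : ℕ → ℕ → ℝ} {CU : (ℕ → ℝ) → ℕ → ℝ}
  {uA : ℕ → ι → C.BgA} {uB : ℕ → ι → C.BgB}
  -- N17's letters: constant `c`, rate `θ`, box side `γ₄`; node U2's history moduli `Λ₄` with fading constant `C₄` at memory rate `ν`; `β′`
  {c θ γ₄ C₄ ν β' : ℝ} {Λ₄ : ℕ → ℕ → ℝ}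

/-! ## §1 N17 itself on the AF-free gap road -/

/-- **N27 = B5 AT THE DATUM, ∃-PACKAGE FORM, WITH N17 ITSELF BY NAME (AF-free gap road).**  File VII §1
(`hybridNE7Under_of_ledgerPackage_tuned`) with the edge hypothesis `hU2` REPLACED by: N17's decl of record `h17 : Spine.NE4.NE4OnData D c θ γ₄`,
node U2's history moduli `hL4 : HistLipschitz Λ₄ γ₄ D.βfun`, `hΛ4 : FadingMemory C₄ ν Λ₄` with the memory gap `ν < θ < 1`, and the PRINTED-type
upper bound `hhi : BetaUpperH β′ γ₄ D.βfun` with `γ₄²β′ < 1` — dag-n17-a's `N17KnitTransfer.u2Output_under_of_N17_gap` turns these into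
`D.UnderHypotheses Hβ (U2Output D g₀ (2c∕(1−θ)) θ)`.  Node U2's output rate is N17's `θ`, so the package's `LedgerAt` is asked at `θc := θ`
(its `rate_gt` reads `max ω θ < L.θ′`).  Everything else as in VII §1 (top level N16 `LocalRate` + liaison, N18, N22, `LipBackground`, `hWin`;
per string the ∃-package with N20 · N21 · budget · E1∕E2 · `PolyLipGrowth` · `LedgerAt` at the clamped tables).  CONCLUSION:
`T4ApexHybrid.HybridNE7Under D Hβ`.  CONDITIONAL on every binder; NE4 NOT thereby proved for Bałaban's β; NOT a discharge. [bookkeeping] [folklore] -/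
theorem hybridNE7Under_of_ledgerPackage_tuned_of_N17 (D : FiniteEpsData F G) {Hβ : Prop}
    (h17 : NE4OnData D c θ γ₄) (hL4 : HistLipschitz Λ₄ γ₄ D.βfun) (hΛ4 : FadingMemory C₄ ν Λ₄)
    (hc : 0 ≤ c) (hC₄ : 0 ≤ C₄) (hν0 : 0 ≤ ν) (hνθ : ν < θ) (hθ1 : θ < 1) (hγ₄ : 0 < γ₄)
    (hhi : BetaUpperH β' γ₄ D.βfun) (hγβ : γ₄ ^ 2 * β' < 1)
    (hγu : 0 < γu) (hWin : Window γu ⊆ Wset)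
    (hloc : LocalRate R C₃ θ₃) (hC₃ : 0 ≤ C₃) (hθ₃ : 0 ≤ θ₃) (hθ₃1 : θ₃ < 1) (hgd : GaugeDominated R uA uB)
    (h18 : NE5 EA EB Wset κ θ₅ C₅) (hθ₅ : 0 ≤ θ₅) (hC₅ : 0 ≤ C₅)
    (h22 : NE9 EA Wset κ Λm ∧ FadingMemory C₉ ω Λm) (hω : 0 ≤ ω)
    (hUL : LipBackground EA Wset κ CU) (hP : 0 ≤ P)
    (hPkg : D.UnderHypotheses Hβ fun g₀ => ∀ os : List (ULoop F),
      ∃ (σ : Type) (_ : DecidableEq σ) (L : LedgerData C ι σ) (l₀ vol : ℝ) (K₀ : ℕ) (T : ℕ → Finset σ)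
        (Bad : ℕ → ℝ → Finset σ) (A B shA shB : ℕ → ℝ → σ → ℝ) (W Wsh : ℕ → ℝ),
        0 < l₀ ∧ 0 < vol ∧ RelWeightBound l₀ T A B Bad W ∧ ShellWeightBound l₀ T A B shA shB Wsh ∧ (∀ K, W K + Wsh K < 1) ∧
        (∀ (K : ℕ) (t : ℝ), |t| ≤ l₀ → T4GenFunBounds.schemeZ (D.scheme g₀) os (K₀ + K) t = ∑ τ ∈ T K, A K t τ) ∧
        (∀ (K : ℕ) (t : ℝ), |t| ≤ l₀ → T4GenFunBounds.schemeZ (D.scheme g₀) os (K₀ + K + 1) t = ∑ τ ∈ T K, B K t τ) ∧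
        PolyLipGrowth CU (fun K => extd (prefixOf (runFlow D g₀ (K₀ + K)) (K₀ + K))) P q ∧
        LedgerAt L l₀ vol T Bad (fun K t τ => A K t τ - shA K t τ) (fun K t τ => B K t τ - shB K t τ) R EA EB κ
          (fun K => extd (prefixOf (runFlow D g₀ (K₀ + K)) (K₀ + K))) uA uB ω θ θ₅ θ₃) :
    T4ApexHybrid.HybridNE7Under D Hβ :=
  have hθ0 : 0 ≤ θ := hν0.trans hνθ.le
  hybridNE7Under_of_ledgerPackage_tuned D hγu hWin hloc hC₃ hθ₃ hθ₃1 hgd h18 hθ₅ hC₅ h22 hω hUL hP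
    (div_nonneg (mul_nonneg zero_le_two hc) (sub_nonneg.mpr hθ1.le)) hθ0
    (u2Output_under_of_N17_gap D h17 hL4 hΛ4 hc hC₄ hν0 hνθ hθ1 hγ₄ hhi hγβ) hPkg

variable {σ : Type} [DecidableEq σ]
  {L : (ℕ → ℝ) → List (ULoop F) → LedgerData C ι σ}
  {l₀ vol : (ℕ → ℝ) → List (ULoop F) → ℝ} {K₀ : (ℕ → ℝ) → List (ULoop F) → ℕ}
  {g : (ℕ → ℝ) → List (ULoop F) → ℕ → ℕ → ℝ}
  {T : (ℕ → ℝ) → List (ULoop F) → ℕ → Finset σ} {Bad : (ℕ → ℝ) → List (ULoop F) → ℕ → ℝ → Finset σ}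
  {A B shA shB : (ℕ → ℝ) → List (ULoop F) → ℕ → ℝ → σ → ℝ} {W Wsh : (ℕ → ℝ) → List (ULoop F) → ℕ → ℝ}

/-- **N27 = B5 AT THE DATUM, NAMED-HYPOTHESES FORM (VI §3), WITH N17 ITSELF BY NAME (AF-free gap road).**  File VI §3
(`hybridNE7Under_of_ledgerAtDatum_tuned`) with `hU2` REPLACED by N17 `NE4OnData D c θ γ₄` + node U2's history moduli + `BetaUpperH β′ γ₄ D.βfun`,
`γ₄²β′ < 1` (`u2Output_under_of_N17_gap`); `hLedger` at `θc := θ`.  CONDITIONAL on every binder; NOT a discharge. [bookkeeping] [folklore] -/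
theorem hybridNE7Under_of_ledgerAtDatum_tuned_of_N17 (D : FiniteEpsData F G) {Hβ : Prop}
    (h17 : NE4OnData D c θ γ₄) (hL4 : HistLipschitz Λ₄ γ₄ D.βfun) (hΛ4 : FadingMemory C₄ ν Λ₄)
    (hc : 0 ≤ c) (hC₄ : 0 ≤ C₄) (hν0 : 0 ≤ ν) (hνθ : ν < θ) (hθ1 : θ < 1) (hγ₄ : 0 < γ₄)
    (hhi : BetaUpperH β' γ₄ D.βfun) (hγβ : γ₄ ^ 2 * β' < 1)
    (hg : ∀ g₀ os K, g g₀ os K = extd (prefixOf (runFlow D g₀ (K₀ g₀ os + K)) (K₀ g₀ os + K)))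
    (hγu : 0 < γu) (hWin : Window γu ⊆ Wset)
    (hloc : LocalRate R C₃ θ₃) (hC₃ : 0 ≤ C₃) (hθ₃ : 0 ≤ θ₃) (hθ₃1 : θ₃ < 1) (hgd : GaugeDominated R uA uB)
    (h18 : NE5 EA EB Wset κ θ₅ C₅) (hθ₅ : 0 ≤ θ₅) (hC₅ : 0 ≤ C₅)
    (h22 : NE9 EA Wset κ Λm ∧ FadingMemory C₉ ω Λm) (hω : 0 ≤ ω)
    (hUL : LipBackground EA Wset κ CU) (hP : 0 ≤ P)
    (hK5 : D.UnderHypotheses Hβ fun g₀ => ∀ os : List (ULoop F),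
      0 < l₀ g₀ os ∧ 0 < vol g₀ os ∧
        RelWeightBound (l₀ g₀ os) (T g₀ os) (A g₀ os) (B g₀ os) (Bad g₀ os) (W g₀ os) ∧
        ShellWeightBound (l₀ g₀ os) (T g₀ os) (A g₀ os) (B g₀ os) (shA g₀ os) (shB g₀ os) (Wsh g₀ os) ∧
        (∀ K, W g₀ os K + Wsh g₀ os K < 1) ∧
        (∀ (K : ℕ) (t : ℝ), |t| ≤ l₀ g₀ os →
          T4GenFunBounds.schemeZ (D.scheme g₀) os (K₀ g₀ os + K) t = ∑ τ ∈ T g₀ os K, A g₀ os K t τ) ∧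
        (∀ (K : ℕ) (t : ℝ), |t| ≤ l₀ g₀ os →
          T4GenFunBounds.schemeZ (D.scheme g₀) os (K₀ g₀ os + K + 1) t = ∑ τ ∈ T g₀ os K, B g₀ os K t τ))
    (hG : D.UnderHypotheses Hβ fun g₀ => ∀ os : List (ULoop F), PolyLipGrowth CU (g g₀ os) P q)
    (hLedger : D.UnderHypotheses Hβ fun g₀ => ∀ os : List (ULoop F),
      LedgerAt (L g₀ os) (l₀ g₀ os) (vol g₀ os) (T g₀ os) (Bad g₀ os)
        (fun K t τ => A g₀ os K t τ - shA g₀ os K t τ) (fun K t τ => B g₀ os K t τ - shB g₀ os K t τ)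
        R EA EB κ (g g₀ os) uA uB ω θ θ₅ θ₃) :
    T4ApexHybrid.HybridNE7Under D Hβ :=
  have hθ0 : 0 ≤ θ := hν0.trans hνθ.le
  hybridNE7Under_of_ledgerAtDatum_tuned D hg hγu hWin hloc hC₃ hθ₃ hθ₃1 hgd h18 hθ₅ hC₅ h22 hω hUL hP
    (div_nonneg (mul_nonneg zero_le_two hc) (sub_nonneg.mpr hθ1.le)) hθ0
    (u2Output_under_of_N17_gap D h17 hL4 hΛ4 hc hC₄ hν0 hνθ hθ1 hγ₄ hhi hγβ) hK5 hG hLedger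

/-! ## §2 N17 at the β of record: every β-side hypothesis read on the merged family -/

variable {βm : HBeta} {β0 : ℕ → ℝ} {γ : ℝ}

/-- **N27 = B5 AT A DATUM CARRYING THE β OF RECORD, ∃-PACKAGE FORM.**  For a finite-`ε` datum whose β-family IS NODE 00's β of record,
`hD : D.βfun = Node00.betaOfMerged βm β⁰ γ` (the Stage-8 datum by construction), and a box side `γ₄ ≤ γ` (`0 < γ₄`): §1 with N17 read as
`ScaleShiftRate c θ γ₄ βm` (dag-n17-a `N17_atRecord_iff_merged`), node U2's moduli as `HistLipschitz Λ₄ γ₄ βm` (`histLipschitz_betaOfMerged_iff`),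
the printed-type bound as `BetaUpperH β′ γ₄ βm` (dag-n28-a `betaUpperH_betaOfMerged_iff`) — every β-side hypothesis ON THE MERGED FAMILY, the
off-box convention of `betaOfMerged` being invisible on the boxes.  CONCLUSION: `T4ApexHybrid.HybridNE7Under D Hβ`.  CONDITIONAL on every
binder; nothing of Bałaban's instantiated (`βm`, `β⁰` abstract); NOT a discharge. [bookkeeping] [folklore] -/
theorem hybridNE7Under_of_ledgerPackage_tuned_atBetaOfRecord (D : FiniteEpsData F G) {Hβ : Prop}
    (hD : D.βfun = betaOfMerged βm β0 γ) (hγ₄γ : γ₄ ≤ γ)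
    (h17 : ScaleShiftRate c θ γ₄ βm) (hL4 : HistLipschitz Λ₄ γ₄ βm) (hΛ4 : FadingMemory C₄ ν Λ₄)
    (hc : 0 ≤ c) (hC₄ : 0 ≤ C₄) (hν0 : 0 ≤ ν) (hνθ : ν < θ) (hθ1 : θ < 1) (hγ₄ : 0 < γ₄)
    (hhi : BetaUpperH β' γ₄ βm) (hγβ : γ₄ ^ 2 * β' < 1)
    (hγu : 0 < γu) (hWin : Window γu ⊆ Wset)
    (hloc : LocalRate R C₃ θ₃) (hC₃ : 0 ≤ C₃) (hθ₃ : 0 ≤ θ₃) (hθ₃1 : θ₃ < 1) (hgd : GaugeDominated R uA uB)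
    (h18 : NE5 EA EB Wset κ θ₅ C₅) (hθ₅ : 0 ≤ θ₅) (hC₅ : 0 ≤ C₅)
    (h22 : NE9 EA Wset κ Λm ∧ FadingMemory C₉ ω Λm) (hω : 0 ≤ ω)
    (hUL : LipBackground EA Wset κ CU) (hP : 0 ≤ P)
    (hPkg : D.UnderHypotheses Hβ fun g₀ => ∀ os : List (ULoop F),
      ∃ (σ : Type) (_ : DecidableEq σ) (L : LedgerData C ι σ) (l₀ vol : ℝ) (K₀ : ℕ) (T : ℕ → Finset σ)
        (Bad : ℕ → ℝ → Finset σ) (A B shA shB : ℕ → ℝ → σ → ℝ) (W Wsh : ℕ → ℝ),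
        0 < l₀ ∧ 0 < vol ∧ RelWeightBound l₀ T A B Bad W ∧ ShellWeightBound l₀ T A B shA shB Wsh ∧ (∀ K, W K + Wsh K < 1) ∧
        (∀ (K : ℕ) (t : ℝ), |t| ≤ l₀ → T4GenFunBounds.schemeZ (D.scheme g₀) os (K₀ + K) t = ∑ τ ∈ T K, A K t τ) ∧
        (∀ (K : ℕ) (t : ℝ), |t| ≤ l₀ → T4GenFunBounds.schemeZ (D.scheme g₀) os (K₀ + K + 1) t = ∑ τ ∈ T K, B K t τ) ∧
        PolyLipGrowth CU (fun K => extd (prefixOf (runFlow D g₀ (K₀ + K)) (K₀ + K))) P q ∧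
        LedgerAt L l₀ vol T Bad (fun K t τ => A K t τ - shA K t τ) (fun K t τ => B K t τ - shB K t τ) R EA EB κ
          (fun K => extd (prefixOf (runFlow D g₀ (K₀ + K)) (K₀ + K))) uA uB ω θ θ₅ θ₃) :
    T4ApexHybrid.HybridNE7Under D Hβ :=
  have hL4' : HistLipschitz Λ₄ γ₄ D.βfun := by rw [hD]; exact (histLipschitz_betaOfMerged_iff hγ₄γ).mpr hL4
  have hhi' : BetaUpperH β' γ₄ D.βfun := by rw [hD]; exact (betaUpperH_betaOfMerged_iff hγ₄γ).mpr hhi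
  hybridNE7Under_of_ledgerPackage_tuned_of_N17 D ((N17_atRecord_iff_merged D hD hγ₄γ).mpr h17) hL4' hΛ4 hc hC₄ hν0 hνθ
    hθ1 hγ₄ hhi' hγβ hγu hWin hloc hC₃ hθ₃ hθ₃1 hgd h18 hθ₅ hC₅ h22 hω hUL hP hPkg

/-- **N27 = B5 AT A DATUM CARRYING THE β OF RECORD, NAMED-HYPOTHESES FORM** — `hybridNE7Under_of_ledgerAtDatum_tuned_of_N17` with
`D.βfun = Node00.betaOfMerged βm β⁰ γ`, `γ₄ ≤ γ`, and N17 ∕ the moduli ∕ the upper bound read on the merged family `βm`.  CONDITIONAL on every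
binder; NOT a discharge. [bookkeeping] [folklore] -/
theorem hybridNE7Under_of_ledgerAtDatum_tuned_atBetaOfRecord (D : FiniteEpsData F G) {Hβ : Prop}
    (hD : D.βfun = betaOfMerged βm β0 γ) (hγ₄γ : γ₄ ≤ γ)
    (h17 : ScaleShiftRate c θ γ₄ βm) (hL4 : HistLipschitz Λ₄ γ₄ βm) (hΛ4 : FadingMemory C₄ ν Λ₄)
    (hc : 0 ≤ c) (hC₄ : 0 ≤ C₄) (hν0 : 0 ≤ ν) (hνθ : ν < θ) (hθ1 : θ < 1) (hγ₄ : 0 < γ₄)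
    (hhi : BetaUpperH β' γ₄ βm) (hγβ : γ₄ ^ 2 * β' < 1)
    (hg : ∀ g₀ os K, g g₀ os K = extd (prefixOf (runFlow D g₀ (K₀ g₀ os + K)) (K₀ g₀ os + K)))
    (hγu : 0 < γu) (hWin : Window γu ⊆ Wset)
    (hloc : LocalRate R C₃ θ₃) (hC₃ : 0 ≤ C₃) (hθ₃ : 0 ≤ θ₃) (hθ₃1 : θ₃ < 1) (hgd : GaugeDominated R uA uB)
    (h18 : NE5 EA EB Wset κ θ₅ C₅) (hθ₅ : 0 ≤ θ₅) (hC₅ : 0 ≤ C₅)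
    (h22 : NE9 EA Wset κ Λm ∧ FadingMemory C₉ ω Λm) (hω : 0 ≤ ω)
    (hUL : LipBackground EA Wset κ CU) (hP : 0 ≤ P)
    (hK5 : D.UnderHypotheses Hβ fun g₀ => ∀ os : List (ULoop F),
      0 < l₀ g₀ os ∧ 0 < vol g₀ os ∧
        RelWeightBound (l₀ g₀ os) (T g₀ os) (A g₀ os) (B g₀ os) (Bad g₀ os) (W g₀ os) ∧
        ShellWeightBound (l₀ g₀ os) (T g₀ os) (A g₀ os) (B g₀ os) (shA g₀ os) (shB g₀ os) (Wsh g₀ os) ∧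
        (∀ K, W g₀ os K + Wsh g₀ os K < 1) ∧
        (∀ (K : ℕ) (t : ℝ), |t| ≤ l₀ g₀ os →
          T4GenFunBounds.schemeZ (D.scheme g₀) os (K₀ g₀ os + K) t = ∑ τ ∈ T g₀ os K, A g₀ os K t τ) ∧
        (∀ (K : ℕ) (t : ℝ), |t| ≤ l₀ g₀ os →
          T4GenFunBounds.schemeZ (D.scheme g₀) os (K₀ g₀ os + K + 1) t = ∑ τ ∈ T g₀ os K, B g₀ os K t τ))
    (hG : D.UnderHypotheses Hβ fun g₀ => ∀ os : List (ULoop F), PolyLipGrowth CU (g g₀ os) P q)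
    (hLedger : D.UnderHypotheses Hβ fun g₀ => ∀ os : List (ULoop F),
      LedgerAt (L g₀ os) (l₀ g₀ os) (vol g₀ os) (T g₀ os) (Bad g₀ os)
        (fun K t τ => A g₀ os K t τ - shA g₀ os K t τ) (fun K t τ => B g₀ os K t τ - shB g₀ os K t τ)
        R EA EB κ (g g₀ os) uA uB ω θ θ₅ θ₃) :
    T4ApexHybrid.HybridNE7Under D Hβ :=
  have hL4' : HistLipschitz Λ₄ γ₄ D.βfun := by rw [hD]; exact (histLipschitz_betaOfMerged_iff hγ₄γ).mpr hL4
  have hhi' : BetaUpperH β' γ₄ D.βfun := by rw [hD]; exact (betaUpperH_betaOfMerged_iff hγ₄γ).mpr hhi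
  hybridNE7Under_of_ledgerAtDatum_tuned_of_N17 D ((N17_atRecord_iff_merged D hD hγ₄γ).mpr h17) hL4' hΛ4 hc hC₄ hν0 hνθ
    hθ1 hγ₄ hhi' hγβ hg hγu hWin hloc hC₃ hθ₃ hθ₃1 hgd h18 hθ₅ hC₅ h22 hω hUL hP hK5 hG hLedger

/-! ## §3 Every K4 child by its DECL column: N16 as `NE3Shape`, N17 as `NE4OnData D`, N18 as `NE5`, N22 as `NE9 ∧ FadingMemory` -/

/-- **N27 = B5 AT THE DATUM FROM THE K4 CHILDREN'S DECL COLUMNS AND THE K5 LINK RECORD** (∃-package form): N16 `h16 : T4EtaRateMin.NE3Shape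
R C₃ θ₃` (dag-n16-a's statement of record; its `pointwise` half and honest rate feed the knit) + liaison `hgd`, N17 `h17 : Spine.NE4.NE4OnData D c θ γ₄`
+ node U2's moduli + the printed-type β bound, N18 `h18 : T4OutputRate.NE5 EA EB Wset κ θ₅ C₅`, N22 `h22 : T4OutputRate.NE9 EA Wset κ Λm ∧
FadingMemory C₉ ω Λm`, node U3's `LipBackground`, `hWin`; under the prefix the per-string ∃-package with N20 `RelWeightBound` · N21
`ShellWeightBound` · budget · E1∕E2 · `PolyLipGrowth` · N19's Link record `LedgerAt` ⇒ `T4ApexHybrid.HybridNE7Under D Hβ` — the field-by-field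
table of `HybridNE7` in theorem form (§1 with `hloc := h16.pointwise`).  CONDITIONAL on every binder; none of NE3∕NE4∕NE5∕NE9∕NE7b∕NE7c is
thereby proved; NOT a discharge. [bookkeeping] [folklore] -/
theorem hybridNE7Under_of_ledgerPackage_tuned_of_declColumns (D : FiniteEpsData F G) {Hβ : Prop}
    (h16 : T4EtaRateMin.NE3Shape R C₃ θ₃) (hC₃ : 0 ≤ C₃) (hgd : GaugeDominated R uA uB)
    (h17 : NE4OnData D c θ γ₄) (hL4 : HistLipschitz Λ₄ γ₄ D.βfun) (hΛ4 : FadingMemory C₄ ν Λ₄)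
    (hc : 0 ≤ c) (hC₄ : 0 ≤ C₄) (hν0 : 0 ≤ ν) (hνθ : ν < θ) (hθ1 : θ < 1) (hγ₄ : 0 < γ₄)
    (hhi : BetaUpperH β' γ₄ D.βfun) (hγβ : γ₄ ^ 2 * β' < 1)
    (h18 : NE5 EA EB Wset κ θ₅ C₅) (hθ₅ : 0 ≤ θ₅) (hC₅ : 0 ≤ C₅)
    (h22 : NE9 EA Wset κ Λm ∧ FadingMemory C₉ ω Λm) (hω : 0 ≤ ω)
    (hUL : LipBackground EA Wset κ CU) (hP : 0 ≤ P) (hγu : 0 < γu) (hWin : Window γu ⊆ Wset)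
    (hPkg : D.UnderHypotheses Hβ fun g₀ => ∀ os : List (ULoop F),
      ∃ (σ : Type) (_ : DecidableEq σ) (L : LedgerData C ι σ) (l₀ vol : ℝ) (K₀ : ℕ) (T : ℕ → Finset σ)
        (Bad : ℕ → ℝ → Finset σ) (A B shA shB : ℕ → ℝ → σ → ℝ) (W Wsh : ℕ → ℝ),
        0 < l₀ ∧ 0 < vol ∧ RelWeightBound l₀ T A B Bad W ∧ ShellWeightBound l₀ T A B shA shB Wsh ∧ (∀ K, W K + Wsh K < 1) ∧
        (∀ (K : ℕ) (t : ℝ), |t| ≤ l₀ → T4GenFunBounds.schemeZ (D.scheme g₀) os (K₀ + K) t = ∑ τ ∈ T K, A K t τ) ∧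
        (∀ (K : ℕ) (t : ℝ), |t| ≤ l₀ → T4GenFunBounds.schemeZ (D.scheme g₀) os (K₀ + K + 1) t = ∑ τ ∈ T K, B K t τ) ∧
        PolyLipGrowth CU (fun K => extd (prefixOf (runFlow D g₀ (K₀ + K)) (K₀ + K))) P q ∧
        LedgerAt L l₀ vol T Bad (fun K t τ => A K t τ - shA K t τ) (fun K t τ => B K t τ - shB K t τ) R EA EB κ
          (fun K => extd (prefixOf (runFlow D g₀ (K₀ + K)) (K₀ + K))) uA uB ω θ θ₅ θ₃) :
    T4ApexHybrid.HybridNE7Under D Hβ :=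
  hybridNE7Under_of_ledgerPackage_tuned_of_N17 D h17 hL4 hΛ4 hc hC₄ hν0 hνθ hθ1 hγ₄ hhi hγβ hγu hWin h16.pointwise hC₃
    h16.rate_nonneg h16.rate_lt_one hgd h18 hθ₅ hC₅ h22 hω hUL hP hPkg

end Datum

end Summit.QuantumFields.YangMills.Theorems.BalabanUVNodesN27SpineRecord
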